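import Mathlib
import Summits.ValiantsHypothesis.ValiantsHypothesis.Theorems.KPlusLogSqLawTropicalBTwoSidedSeparableCensus

/-!
# Route «KPlusLogSqLaw», crux `TropicalB` (stmt-ValiantsHypothesis-19771) — THE TWO-SIDED SEPARABLE SECTOR, part 6: THE FLOOR
# `m(K−1)` breakpoints inside the sector for EVERY strictly increasing `e`; the `K = 3` row of the sector is EXACTLY `2m`

HONEST FRAMING.  Helper toward the registered stubs `stub_tropThin` / `stub_tropFat` of `Cruxes/TropicalB/Lines/birth.lean` (crux
`Summit.ValiantsHypothesis.ValiantsHypothesis.Theses.KPlusLogSqLaw.TropicalB`, item stmt-ValiantsHypothesis-19771, route KPlusLogSqLaw;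
cell `pub-symmetroid`, seat val-sym-trop-p1 g19, 2026-08-28; `--supports … --as helper`).  A CALIBRATION row (explicit designs, lower
bound) for the sector of parts 2–5; it bounds nothing for `TropicalB` and bears on neither `WeakLifting`, the doors, `MatrixDescartes`
(stmt-ValiantsHypothesis-18050) nor VP ≠ VNP.

THE DESIGN (row-separable, inside the sector: `c = 0`, tie-break `w a b = [a ≠ b]`, `B = 1`, `M = m + 1`, full support `ε = 1`).  For a
strictly increasing `e : Fin K → ℕ` put `r a l = (2a(K−1) + 2l + 1)·e l − 2·Σ_{j ≤ l} e j`, so that row `a` prefers class `l + 1` to class `l`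
exactly from the slope `2a(K−1) + 2l + 1` on: at the even slope `θ = 2t` the unique best class of row `a` is `min(K−1, t ∸ a(K−1))` — the rows
climb through all classes one after the other — and the identity permutation is the unique minimiser of the tie-break.  Hence the terms
`p_t = (id, b ↦ min(K−1, t ∸ b(K−1)))`, `t = 0, …, m(K−1)`, are dominant at `θ = 2t`: a chain with `m(K−1)` breakpoints (`exists_floor_chain`),
so the sector's unsigned row is at least `m(K−1)` (`not_designRowD_floor`), and with part 5 (`designRowD_three`) **the `K = 3` row of the
sector is exactly `2m`** (`three_row_exact`: some sector design has `2m` breakpoints, every sector design has at most `2m`).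
[this file]
-/

set_option linter.dupNamespace false
set_option autoImplicit false

namespace Summit.ValiantsHypothesis.ValiantsHypothesis.Theorems.KPlusLogSqLaw

namespace TwoSided

open Summit.ValiantsHypothesis.ValiantsHypothesis.Theorems.MatrixDescartes.Negative
open scoped BigOperators
open Finset

variable {m K : ℕ}

/-! ## 1. One row: a unimodal profile with a prescribed peak -/

/-- **Row profile, one step.**  With `f l = (T − 2l − 1)·e l + 2·Σ_{j ≤ l} e j`:  `f (l+1) − f l = (T − 2l − 1)·(e (l+1) − e l)`.
[this file] -/
theorem profile_step (e : Fin K → ℕ) (T : ℤ) (l : Fin K) (hl : (l : ℕ) + 1 < K) :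
    ((T - 2 * ((l : ℕ) + 1 : ℕ) - 1) * (e ⟨l + 1, hl⟩ : ℤ) + 2 * ∑ j : Fin K, (if (j : ℕ) ≤ (l : ℕ) + 1 then (e j : ℤ) else 0)) -
      ((T - 2 * (l : ℕ) - 1) * (e l : ℤ) + 2 * ∑ j : Fin K, (if (j : ℕ) ≤ (l : ℕ) then (e j : ℤ) else 0)) =
      (T - 2 * (l : ℕ) - 1) * ((e ⟨l + 1, hl⟩ : ℤ) - e l) := by
  have hsum : ∑ j : Fin K, (if (j : ℕ) ≤ (l : ℕ) + 1 then (e j : ℤ) else 0) =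
      ∑ j : Fin K, (if (j : ℕ) ≤ (l : ℕ) then (e j : ℤ) else 0) + e ⟨l + 1, hl⟩ := by
    rw [← Finset.sum_erase_add _ _ (Finset.mem_univ (⟨(l : ℕ) + 1, hl⟩ : Fin K)), ← Finset.sum_erase_add univ
      (fun j : Fin K => if (j : ℕ) ≤ (l : ℕ) then (e j : ℤ) else 0) (Finset.mem_univ (⟨(l : ℕ) + 1, hl⟩ : Fin K))]
    simp only [le_refl, if_true, add_le_iff_nonpos_right, nonpos_iff_eq_zero, one_ne_zero, if_false, add_zero]
    congr 1
    refine Finset.sum_congr rfl fun j hj => ?_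
    have hne : j ≠ ⟨(l : ℕ) + 1, hl⟩ := Finset.ne_of_mem_erase hj
    have hne' : (j : ℕ) ≠ (l : ℕ) + 1 := fun h => hne (Fin.ext h)
    by_cases h1 : (j : ℕ) ≤ (l : ℕ)
    · rw [if_pos (by omega), if_pos h1]
    · rw [if_neg (by omega), if_neg h1]
  rw [hsum]
  push_cast
  ring


/-- chaining strict increases: `k + 1` consecutive up-steps from `i`. [folklore] -/
theorem lt_of_steps_up (g : ℕ → ℤ) (lo hi : ℕ) (h : ∀ i, lo ≤ i → i < hi → g i < g (i + 1)) :
    ∀ k i, lo ≤ i → i + k < hi → g i < g (i + k + 1) := by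
  intro k
  induction k with
  | zero => intro i hlo hk; simpa using h i hlo (by omega)
  | succ k ih =>
    intro i hlo hk
    have h1 := ih i hlo (by omega)
    have h2 := h (i + k + 1) (by omega) (by omega)
    rw [show i + (k + 1) + 1 = i + k + 1 + 1 by omega]
    exact h1.trans h2

/-- chaining strict decreases: `k + 1` consecutive down-steps from `i`. [folklore] -/
theorem lt_of_steps_down (g : ℕ → ℤ) (lo hi : ℕ) (h : ∀ i, lo ≤ i → i < hi → g (i + 1) < g i) :
    ∀ k i, lo ≤ i → i + k < hi → g (i + k + 1) < g i := by
  intro k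
  induction k with
  | zero => intro i hlo hk; simpa using h i hlo (by omega)
  | succ k ih =>
    intro i hlo hk
    have h1 := ih i hlo (by omega)
    have h2 := h (i + k + 1) (by omega) (by omega)
    rw [show i + (k + 1) + 1 = i + k + 1 + 1 by omega]
    exact h2.trans h1

/-- **Row profile, the peak.**  For strictly increasing `e`, an integer `T` and `l⋆ < K` with `2l + 1 < T` for `l < l⋆` and `T < 2l + 1` for
`l⋆ ≤ l < K − 1`, the profile `f l = (T − 2l − 1)·e l + 2·Σ_{j ≤ l} e j` is uniquely maximised at `l⋆`. [this file] -/
theorem profile_lt_peak (e : Fin K → ℕ) (he : StrictMono e) (T : ℤ) (ls : ℕ) (hls : ls < K)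
    (hup : ∀ l : ℕ, l < ls → (2 * l + 1 : ℤ) < T) (hdown : ∀ l : ℕ, ls ≤ l → l + 1 < K → T < 2 * l + 1)
    (l : Fin K) (hl : (l : ℕ) ≠ ls) :
    (T - 2 * (l : ℕ) - 1) * (e l : ℤ) + 2 * ∑ j : Fin K, (if (j : ℕ) ≤ (l : ℕ) then (e j : ℤ) else 0) <
      (T - 2 * ls - 1) * (e ⟨ls, hls⟩ : ℤ) + 2 * ∑ j : Fin K, (if (j : ℕ) ≤ ls then (e j : ℤ) else 0) := by
  -- the profile as a function on `ℕ`
  let g : ℕ → ℤ := fun i => if h : i < K then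
      (T - 2 * i - 1) * (e ⟨i, h⟩ : ℤ) + 2 * ∑ j : Fin K, (if (j : ℕ) ≤ i then (e j : ℤ) else 0) else 0
  have hg : ∀ (i : ℕ) (h : i < K), g i = (T - 2 * i - 1) * (e ⟨i, h⟩ : ℤ) + 2 * ∑ j : Fin K, (if (j : ℕ) ≤ i then (e j : ℤ) else 0) :=
    fun i h => dif_pos h
  have hstep : ∀ (i : ℕ) (h : i + 1 < K), g (i + 1) - g i = (T - 2 * i - 1) * ((e ⟨i + 1, h⟩ : ℤ) - e ⟨i, by omega⟩) := by
    intro i h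
    rw [hg (i + 1) h, hg i (by omega)]
    have := profile_step e T ⟨i, by omega⟩ h
    simpa using this
  have hemono : ∀ (i : ℕ) (h : i + 1 < K), (e ⟨i, by omega⟩ : ℤ) < e ⟨i + 1, h⟩ := by
    intro i h; exact_mod_cast he (Fin.mk_lt_mk.mpr (Nat.lt_succ_self i))
  have hl' := l.isLt
  rw [← hg l l.isLt, ← hg ls hls]
  rcases Nat.lt_or_gt_of_ne hl with hlt | hgt
  · -- below the peak: climb
    have hsteps : ∀ i, 0 ≤ i → i < ls → g i < g (i + 1) := by
      intro i _ hi
      have hiK : i + 1 < K := by omega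
      have := hstep i hiK
      have hpos : 0 < (T - 2 * i - 1) * ((e ⟨i + 1, hiK⟩ : ℤ) - e ⟨i, by omega⟩) :=
        mul_pos (by have := hup i hi; omega) (by have := hemono i hiK; omega)
      omega
    have := lt_of_steps_up g 0 ls hsteps (ls - (l : ℕ) - 1) l (Nat.zero_le _) (by omega)
    rwa [show (l : ℕ) + (ls - (l : ℕ) - 1) + 1 = ls by omega] at this
  · -- above the peak: descend
    have hsteps : ∀ i, ls ≤ i → i < (l : ℕ) → g (i + 1) < g i := by
      intro i hlo hi
      have hiK : i + 1 < K := by omega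
      have := hstep i hiK
      have hneg : (T - 2 * i - 1) * ((e ⟨i + 1, hiK⟩ : ℤ) - e ⟨i, by omega⟩) < 0 :=
        mul_neg_of_neg_of_pos (by have := hdown i hlo hiK; omega) (by have := hemono i hiK; omega)
      omega
    have := lt_of_steps_down g ls (l : ℕ) hsteps ((l : ℕ) - ls - 1) ls le_rfl (by omega)
    rwa [show ls + ((l : ℕ) - ls - 1) + 1 = (l : ℕ) by omega] at this

/-! ## 2. The floor design and its chain -/

/-- **The floor of the sector.**  For `m ≥ 1`, `K ≥ 2` and every strictly increasing `e : Fin K → ℕ` there is a two-sided separable design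
with a fine tie-break (row-separable: `c = 0`, `w a b = [a ≠ b]`, `B = 1`, `M = m + 1`, `ε = 1`) carrying a chain of unique optima at the even
slopes `0, 2, …, 2m(K−1)` with consecutive terms distinct — `m(K−1)` breakpoints. [this file] -/
theorem exists_floor_chain (hm : 1 ≤ m) (hK : 2 ≤ K) (e : Fin K → ℕ) (he : StrictMono e) :
    ∃ (M : ℕ) (d : Fin K → ℕ) (r c : Fin m → Fin K → ℤ) (w : Fin m → Fin m → ℤ) (B : ℤ) (v ε : Fin m → Fin m → Fin K → ℤ),
      (∀ l, d l = M * e l) ∧ (∀ a b, 0 ≤ w a b) ∧ (∀ a b, w a b ≤ B) ∧ ((m : ℤ) * B < M) ∧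
      (∀ a b l, v a b l = (M : ℤ) * (r a l + c b l) + w a b) ∧ (∀ a b l, ε a b l ≠ 0) ∧ (∀ a b l, (ε a b l).natAbs ≤ 1) ∧
      ∃ (θ : Fin (m * (K - 1) + 1) → ℤ) (p : Fin (m * (K - 1) + 1) → Equiv.Perm (Fin m) × (Fin m → Fin K)),
        StrictMono θ ∧ (∀ k, IsDominant d v ε (θ k) (p k)) ∧ (∀ k : Fin (m * (K - 1)), p k.castSucc ≠ p k.succ) := by
  classical
  -- the design
  let r : Fin m → Fin K → ℤ := fun a l =>
    (2 * (a : ℕ) * (K - 1 : ℕ) + 2 * (l : ℕ) + 1 : ℤ) * (e l : ℤ) - 2 * ∑ j : Fin K, (if (j : ℕ) ≤ (l : ℕ) then (e j : ℤ) else 0)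
  let w : Fin m → Fin m → ℤ := fun a b => if a = b then 0 else 1
  let v : Fin m → Fin m → Fin K → ℤ := fun a b l => ((m + 1 : ℕ) : ℤ) * (r a l + 0) + w a b
  -- the chain: at slope `2t` row `b` sits in class `min (K−1) (t ∸ b(K−1))`
  let cls : ℕ → Fin m → Fin K := fun t b => ⟨min (K - 1) (t - (b : ℕ) * (K - 1)), by omega⟩
  refine ⟨m + 1, fun l => (m + 1) * e l, r, fun _ _ => 0, w, 1, v, fun _ _ _ => 1, fun l => rfl, ?_, ?_, ?_, ?_, ?_, ?_,
    fun k => 2 * (k : ℕ), fun k => (1, cls k), ?_, ?_, ?_⟩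
  · intro a b; simp only [w]; split_ifs <;> norm_num
  · intro a b; simp only [w]; split_ifs <;> norm_num
  · push_cast; linarith
  · intro a b l; rfl
  · intro a b l; norm_num
  · intro a b l; norm_num
  · intro i j hij; simp only; exact_mod_cast Nat.mul_lt_mul_of_pos_left (Fin.lt_def.mp hij) two_pos
  · -- dominance of `(id, cls t)` at slope `2t`
    intro k
    have hfull : ∀ q : Equiv.Perm (Fin m) × (Fin m → Fin K), termSign (fun _ _ _ => (1 : ℤ)) q ≠ 0 :=
      fun q => termSign_ne_zero_of_full _ (fun _ _ _ => one_ne_zero) q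
    refine ⟨hfull _, fun q hq _ => ?_⟩
    -- the per-row profile and its peak
    set t : ℕ := (k : ℕ) with ht
    have hpeak : ∀ (a : Fin m) (l : Fin K), l ≠ cls t a →
        (2 * (t : ℤ)) * ((m + 1 : ℕ) * e l : ℕ) - (((m + 1 : ℕ) : ℤ) * (r a l + 0)) <
          (2 * (t : ℤ)) * ((m + 1 : ℕ) * e (cls t a) : ℕ) - (((m + 1 : ℕ) : ℤ) * (r a (cls t a) + 0)) := by
      intro a l hl
      set A : ℕ := (a : ℕ) * (K - 1) with hA
      have hls : min (K - 1) (t - A) < K := lt_of_le_of_lt (min_le_left _ _) (by omega)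
      have hl' : (l : ℕ) ≠ min (K - 1) (t - A) := fun h => hl (Fin.ext h)
      have key := profile_lt_peak e he (2 * (t : ℤ) - 2 * (A : ℕ)) (min (K - 1) (t - A)) hls
        (fun l hl => by have := (lt_min_iff.mp hl).2; omega)
        (fun l hl hlK => by
          rcases min_le_iff.mp hl with h1 | h1
          · omega
          · omega) l hl'
      -- unfold `r` on both sides and compare with the profile values (times `M = m + 1 > 0`)
      have hM : (0 : ℤ) < ((m + 1 : ℕ) : ℤ) := by positivity
      have expand : ∀ l' : Fin K, (2 * (t : ℤ)) * ((m + 1 : ℕ) * e l' : ℕ) - (((m + 1 : ℕ) : ℤ) * (r a l' + 0)) =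
          ((m + 1 : ℕ) : ℤ) * ((2 * (t : ℤ) - 2 * (A : ℕ) - 2 * (l' : ℕ) - 1) * (e l' : ℤ) +
            2 * ∑ j : Fin K, (if (j : ℕ) ≤ (l' : ℕ) then (e j : ℤ) else 0)) := by
        intro l'; simp only [r, hA]; push_cast; ring
      rw [expand l, expand (cls t a)]
      exact mul_lt_mul_of_pos_left key hM
    -- weights: `tropWeight q = Σ_b [2t·d(λ b) − v(σ b, b, λ b)]`
    have hwq : tropWeight (fun l => (m + 1) * e l) v (2 * (t : ℤ)) q =
        ∑ b, ((2 * (t : ℤ)) * ((m + 1 : ℕ) * e (q.2 b) : ℕ) - (((m + 1 : ℕ) : ℤ) * (r (q.1 b) (q.2 b) + 0))) - ∑ b, w (q.1 b) b := by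
      unfold tropWeight; simp only [v]; rw [Finset.mul_sum, ← Finset.sum_sub_distrib, ← Finset.sum_sub_distrib]
      refine Finset.sum_congr rfl fun b _ => by ring
    have hwp : tropWeight (fun l => (m + 1) * e l) v (2 * (t : ℤ)) ((1 : Equiv.Perm (Fin m)), cls t) =
        ∑ b, ((2 * (t : ℤ)) * ((m + 1 : ℕ) * e (cls t b) : ℕ) - (((m + 1 : ℕ) : ℤ) * (r b (cls t b) + 0))) := by
      unfold tropWeight; simp only [v, w, Equiv.Perm.coe_one, id, if_true]
      rw [Finset.mul_sum, ← Finset.sum_sub_distrib]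
      refine Finset.sum_congr rfl fun b _ => by ring
    rw [hwq, hwp]
    -- row-wise comparison after re-indexing the rows of `q` by its permutation
    have hrows : ∑ b, ((2 * (t : ℤ)) * ((m + 1 : ℕ) * e (q.2 b) : ℕ) - (((m + 1 : ℕ) : ℤ) * (r (q.1 b) (q.2 b) + 0))) ≤
        ∑ b, ((2 * (t : ℤ)) * ((m + 1 : ℕ) * e (cls t (q.1 b)) : ℕ) - (((m + 1 : ℕ) : ℤ) * (r (q.1 b) (cls t (q.1 b)) + 0))) :=
      Finset.sum_le_sum fun b _ => by
        by_cases h : q.2 b = cls t (q.1 b)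
        · rw [h]
        · exact (hpeak (q.1 b) (q.2 b) h).le
    have hreidx : ∑ b, ((2 * (t : ℤ)) * ((m + 1 : ℕ) * e (cls t (q.1 b)) : ℕ) - (((m + 1 : ℕ) : ℤ) * (r (q.1 b) (cls t (q.1 b)) + 0))) =
        ∑ a, ((2 * (t : ℤ)) * ((m + 1 : ℕ) * e (cls t a) : ℕ) - (((m + 1 : ℕ) : ℤ) * (r a (cls t a) + 0))) :=
      Equiv.sum_comp q.1 (fun a => (2 * (t : ℤ)) * ((m + 1 : ℕ) * e (cls t a) : ℕ) - (((m + 1 : ℕ) : ℤ) * (r a (cls t a) + 0)))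
    have hW0 : 0 ≤ ∑ b, w (q.1 b) b := Finset.sum_nonneg fun b _ => by simp only [w]; split_ifs <;> norm_num
    by_cases hσ : q.1 = 1
    · -- same permutation: some column carries a non-peak class
      have hcl : q.2 ≠ cls t := by
        intro h; apply hq; exact Prod.ext hσ h
      obtain ⟨b, hb⟩ : ∃ b, q.2 b ≠ cls t b := by
        by_contra h; push Not at h; exact hcl (funext h)
      have hlt : ∑ b, ((2 * (t : ℤ)) * ((m + 1 : ℕ) * e (q.2 b) : ℕ) - (((m + 1 : ℕ) : ℤ) * (r (q.1 b) (q.2 b) + 0))) <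
          ∑ b, ((2 * (t : ℤ)) * ((m + 1 : ℕ) * e (cls t b) : ℕ) - (((m + 1 : ℕ) : ℤ) * (r b (cls t b) + 0))) := by
        simp only [hσ, Equiv.Perm.coe_one, id]
        exact Finset.sum_lt_sum (fun b' _ => by
          by_cases h : q.2 b' = cls t b'
          · rw [h]
          · exact (hpeak b' (q.2 b') h).le) ⟨b, Finset.mem_univ _, hpeak b (q.2 b) hb⟩
      linarith
    · -- a moved permutation pays the tie-break
      obtain ⟨b, hb⟩ : ∃ b, q.1 b ≠ b := by
        by_contra h; push Not at h; exact hσ (Equiv.ext h)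
      have hW1 : 1 ≤ ∑ b, w (q.1 b) b := by
        have hwb : w (q.1 b) b = 1 := by
          show (if q.1 b = b then (0 : ℤ) else 1) = 1
          rw [if_neg hb]
        have hw0' : ∀ b' ∈ (univ : Finset (Fin m)), 0 ≤ w (q.1 b') b' := fun b' _ => by
          show 0 ≤ (if q.1 b' = b' then (0 : ℤ) else 1)
          split_ifs <;> norm_num
        have := Finset.single_le_sum (f := fun b' => w (q.1 b') b') hw0' (Finset.mem_univ b)
        simp only [hwb] at this
        exact this
      linarith
  · -- consecutive terms differ: the row `⌊k/(K−1)⌋` climbs one class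
    intro k h
    have hk : (k : ℕ) < m * (K - 1) := k.isLt
    have hK1 : 0 < K - 1 := by omega
    set a : ℕ := (k : ℕ) / (K - 1) with ha
    have ham : a < m := (Nat.div_lt_iff_lt_mul hK1).mpr hk
    set A : ℕ := a * (K - 1) with hA
    have h3 : A ≤ (k : ℕ) := Nat.div_mul_le_self _ _
    have h4 : (k : ℕ) < A + (K - 1) := by
      have h5 := Nat.div_add_mod (k : ℕ) (K - 1)
      have h6 := Nat.mod_lt (k : ℕ) hK1
      rw [← ha] at h5
      have hA' : A = (K - 1) * a := by rw [hA, Nat.mul_comm]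
      omega
    have h2 := congrArg (fun q : Equiv.Perm (Fin m) × (Fin m → Fin K) => ((q.2 ⟨a, ham⟩ : Fin K) : ℕ)) h
    simp only [Fin.val_castSucc, Fin.val_succ, cls] at h2
    rw [← hA] at h2
    omega


/-! ## 3. The floor as a census statement; the `K = 3` row is exact -/

/-- **The sector floor in the census currency**: for `m ≥ 1`, `K ≥ 2` and every strictly increasing `e` some design of the sector has an
unsigned dominant chain with `m(K−1)` breakpoints, i.e. violates `DesignRowD … (m(K−1) − 1)`. [this file] -/
theorem exists_not_designRowD_floor (hm : 1 ≤ m) (hK : 2 ≤ K) (e : Fin K → ℕ) (he : StrictMono e) :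
    ∃ (M : ℕ) (d : Fin K → ℕ) (r c : Fin m → Fin K → ℤ) (w : Fin m → Fin m → ℤ) (B : ℤ) (v ε : Fin m → Fin m → Fin K → ℤ),
      (∀ l, d l = M * e l) ∧ (∀ a b, 0 ≤ w a b) ∧ (∀ a b, w a b ≤ B) ∧ ((m : ℤ) * B < M) ∧
      (∀ a b l, v a b l = (M : ℤ) * (r a l + c b l) + w a b) ∧ (∀ a b l, ε a b l ≠ 0) ∧ (∀ a b l, (ε a b l).natAbs ≤ 1) ∧
      ¬ DesignRowD d v ε (m * (K - 1) - 1) := by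
  obtain ⟨M, d, r, c, w, B, v, ε, hd, hw0, hwB, hMB, hv, hε, hε1, θ, p, hθ, hdom, hne⟩ := exists_floor_chain hm hK e he
  refine ⟨M, d, r, c, w, B, v, ε, hd, hw0, hwB, hMB, hv, hε, hε1, fun hrow => ?_⟩
  have h := hrow (m * (K - 1)) θ p hθ hdom hne
  have : 1 ≤ m * (K - 1) := Nat.one_le_iff_ne_zero.mpr (Nat.mul_ne_zero (by omega) (by omega))
  omega

/-- **The `K = 3` row of the two-sided separable sector is EXACTLY `2m`** (for every strictly increasing `e` and every `m ≥ 1`): some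
sector design has `2m` breakpoints (floor), and every sector design has at most `2m` (part 5, `designRowD_three`). [this file] -/
theorem three_row_exact (hm : 1 ≤ m) (e : Fin 3 → ℕ) (he : StrictMono e) :
    (∃ (M : ℕ) (d : Fin 3 → ℕ) (r c : Fin m → Fin 3 → ℤ) (w : Fin m → Fin m → ℤ) (B : ℤ) (v ε : Fin m → Fin m → Fin 3 → ℤ),
      (∀ l, d l = M * e l) ∧ (∀ a b, 0 ≤ w a b) ∧ (∀ a b, w a b ≤ B) ∧ ((m : ℤ) * B < M) ∧
      (∀ a b l, v a b l = (M : ℤ) * (r a l + c b l) + w a b) ∧ (∀ a b l, ε a b l ≠ 0) ∧ (∀ a b l, (ε a b l).natAbs ≤ 1) ∧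
      ¬ DesignRowD d v ε (2 * m - 1)) ∧
    (∀ (M : ℕ) (d : Fin 3 → ℕ) (r c : Fin m → Fin 3 → ℤ) (w : Fin m → Fin m → ℤ) (B : ℤ) (v ε : Fin m → Fin m → Fin 3 → ℤ),
      (∀ l, d l = M * e l) → (∀ a b, 0 ≤ w a b) → (∀ a b, w a b ≤ B) → ((m : ℤ) * B < M) →
      (∀ a b l, v a b l = (M : ℤ) * (r a l + c b l) + w a b) → (∀ a b l, ε a b l ≠ 0) → DesignRowD d v ε (2 * m)) := by
  refine ⟨?_, fun M d r c w B v ε hd hw0 hwB hMB hv hε =>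
    designRowD_three e (he (by decide : (0 : Fin 3) < 1)) (he (by decide : (1 : Fin 3) < 2)) M d hd r c w B hw0 hwB hMB v ε hv hε⟩
  obtain ⟨M, d, r, c, w, B, v, ε, hd, hw0, hwB, hMB, hv, hε, hε1, hrow⟩ := exists_not_designRowD_floor hm (by norm_num) e he
  refine ⟨M, d, r, c, w, B, v, ε, hd, hw0, hwB, hMB, hv, hε, hε1, ?_⟩
  rwa [show m * (3 - 1) - 1 = 2 * m - 1 by omega] at hrow

end TwoSided

end Summit.ValiantsHypothesis.ValiantsHypothesis.Theorems.KPlusLogSqLaw
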